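import Summits.QuantumFields.YangMills.Theorems.AtomicSynthesisTensorTransport
import Summits.QuantumFields.YangMills.Theorems.AtomicSynthesisTensorSeries
import Summits.QuantumFields.YangMills.Theorems.AtomicSynthesisTensorSlot
import Summits.QuantumFields.YangMills.Theorems.AtomicSynthesisMolliApprox
import Summits.QuantumFields.YangMills.Theses.OnsetTautology
import Summits.QuantumFields.YangMills.Theses.MarkovAtoms
import Literature.Analysis.FunctionSpaces.TorusPeriodicLocalization
import HarnessLib

/-!
# Tensorisation (LINE «SlotwiseSynthesis») and the crux AtomicSynthesis ⟨stmt-QuantumFields-28126⟩ BY NAME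

The mathematics of the registered stub `stub_tensorisation : ∀ b C₁ N₁, 0 ≤ C₁ → SlotSynth b C₁ N₁ → SynthFor b`
(skeleton ym-idea-11 g13 `slotwise-synthesis.lean`, sha 78fb3dad) — TENSOR BOOKKEEPING WITH MULTIPLICATIVE CONSTANTS —
as `synthFor_of_slotSynth` (conclusion = the skeleton's `SynthFor b` spelled out; the by-name stub with the registered
abbreviation `SynthFor` is a one-line corollary filed separately), and, with the landed `stub_singleSlot`
(`AtomicSynthesisMolliApprox`, ✓p709440), the crux `OnsetTautology.AtomicSynthesis` and its character-identical copy
`MarkovAtoms.AtomicSynthesis` BY NAME.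

Proof of the stub (all ingredients landed in `AtomicSynthesisTensorTorusFourier / …Series / …Slot / …Transport`):
product Fourier expansion of the `n`-slot function on the cube of side `4ρ` (coefficients `G k`, `k ∈ ℤ^{n×4}`, with the
single-coordinate decay `‖G k‖ ≤ M (2/(π|k_p|))^m`, `m = 4(N₁+2)n` derivatives in the sup coordinate), turned into the
PRODUCT majorant `‖G k‖ ≤ M ∏_p (max 1 |k_p|)^{-(N₁+2)}` (`prod_majorant`); each slot factor
`χ(ρ⁻¹(z_l−c_l)) e_{k_l}(…)` is synthesised from `b`-atoms at cost `2C₁B(1+(π/2)|k_l|₁)^{N₁} ≤ 2C₁B ∏_j (1+2|k_{lj}|)^{N₁}`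
(`slot_hasSum_atoms`); the costs MULTIPLY over the slots and the `k`-sum FACTORISES:
`∑_k ∏_p u(k_p) = (∑_m u m)^{4n}`, `u(m) = (1+2|m|)^{N₁}/(max 1 |m|)^{N₁+2}` summable — whence the crux's constant
`C = 2 C₁ B U⁴` and derivative budget `N = 4(N₁+2)`; finally real parts are taken and the countable index set is
re-enumerated by `ℕ`.

HONEST LABEL: pure approximation theory (the crux says so itself); closes the rank-3 crux AtomicSynthesis of
route OnsetTautology / MarkovAtoms; no rung / leaf / summit statement and NOT the Yang–Mills mass gap.
Cell `ym-idea-1`, width seat `ym-line-sfw-p2-w3` g37 (free hands).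
-/

noncomputable section

open Set Function Filter Topology MeasureTheory Complex
open Literature.Analysis.FunctionSpaces
open Literature.MathematicalPhysics.QuantumLattice (eChar absSum absSum_nonneg abs_le_absSum)
open Summit.QuantumFields.YangMills.Theorems.RPOnsetFloorPosTimeSynthCollar (SlotSynth)
open Summit.QuantumFields.YangMills.Cruxes.AtomicSynthesis.SingleSlotPlan (E4 stub_singleSlot)
open scoped ContDiff Real

namespace Summit.QuantumFields.YangMills.Theorems.AtomicSynthesisTensor

/-! ## §1 Numerical lemmas: the product majorant and the weights -/

/-- The slot cost in PRODUCT form: `(1 + (π/2)|κ|₁)^{N₁} ≤ ∏_j (1 + 2|κ_j|)^{N₁}` (via `1 + ∑ a_j ≤ ∏ (1 + a_j)`).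
[folklore] -/
theorem slot_cost_le_prod {ι : Type*} [Fintype ι] (κ : ι → ℤ) (N₁ : ℕ) :
    (1 + π / 2 * absSum κ) ^ N₁ ≤ ∏ j, (1 + 2 * |(κ j : ℝ)|) ^ N₁ := by
  classical
  -- `1 + ∑_{j ∈ s} 2|κ_j| ≤ ∏_{j ∈ s} (1 + 2|κ_j|)` by induction on `s`
  have hind : ∀ s : Finset ι, 1 + ∑ j ∈ s, 2 * |(κ j : ℝ)| ≤ ∏ j ∈ s, (1 + 2 * |(κ j : ℝ)|) := by
    intro s
    induction s using Finset.induction_on with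
    | empty => simp
    | insert i s hi ih =>
      rw [Finset.sum_insert hi, Finset.prod_insert hi]
      have h0 : (0 : ℝ) ≤ 2 * |(κ i : ℝ)| := by positivity
      have hs : (0 : ℝ) ≤ ∑ j ∈ s, 2 * |(κ j : ℝ)| := Finset.sum_nonneg fun j _ => by positivity
      nlinarith [mul_nonneg h0 hs]
  rw [Finset.prod_pow]
  refine pow_le_pow_left₀ (by positivity [absSum_nonneg κ]) ?_ N₁
  calc 1 + π / 2 * absSum κ ≤ 1 + 2 * absSum κ := by
        have hπ : π / 2 ≤ 2 := by linarith [Real.pi_lt_four]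
        nlinarith [absSum_nonneg κ]
    _ = 1 + ∑ j, 2 * |(κ j : ℝ)| := by rw [absSum, Finset.mul_sum]
    _ ≤ ∏ j, (1 + 2 * |(κ j : ℝ)|) := hind _

/-- **Product majorant from sup-coordinate decay.**  If `0 ≤ x ≤ M` and `x ≤ 4^m M/(2π|k_p|)^m` for every non-zero
coordinate `k_p`, with `m = N'·#d`, then `x ≤ M ∏_p (max 1 |k_p|)^{−N'}`. [folklore] -/
theorem prod_majorant {d : Type*} [Fintype d] (k : d → ℤ) (N' : ℕ) {m : ℕ} (hm : N' * Fintype.card d = m)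
    {x M : ℝ} (hx0 : 0 ≤ x) (h0 : x ≤ M)
    (hdec : ∀ p, k p ≠ 0 → x ≤ 4 ^ m * M / (2 * π * |(k p : ℝ)|) ^ m) :
    x ≤ M * ∏ p, ((max 1 |(k p : ℝ)|) ^ N')⁻¹ := by
  have hM : 0 ≤ M := hx0.trans h0
  by_cases hk : k = 0
  · subst hk
    simpa using h0
  obtain ⟨p₁, hp₁⟩ := Function.ne_iff.1 hk
  obtain ⟨p₀, -, hp₀⟩ := Finset.exists_max_image Finset.univ (fun p => |(k p : ℝ)|) ⟨p₁, Finset.mem_univ _⟩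
  set R : ℝ := |(k p₀ : ℝ)| with hR
  have hR1 : 1 ≤ R := by
    have h1 : (1 : ℝ) ≤ |(k p₁ : ℝ)| := by exact_mod_cast Int.one_le_abs hp₁
    exact h1.trans (hp₀ p₁ (Finset.mem_univ _))
  have hRpos : 0 < R := lt_of_lt_of_le one_pos hR1
  have hkp₀ : k p₀ ≠ 0 := by
    intro h; rw [hR, h] at hR1; norm_num at hR1
  refine (hdec p₀ hkp₀).trans ?_
  -- `4^m M/(2πR)^m = M (2/(πR))^m ≤ M R^{-m} = M ∏_p R^{-N'} ≤ M ∏_p (max 1 |k_p|)^{-N'}`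
  have h2π : (2 : ℝ) / π ≤ 1 := by
    rw [div_le_one Real.pi_pos]; linarith [Real.pi_gt_three]
  have hstep : 4 ^ m * M / (2 * π * R) ^ m ≤ M * (R ^ m)⁻¹ := by
    have heq : 4 ^ m * M / (2 * π * R) ^ m = (2 / π) ^ m * (M * (R ^ m)⁻¹) := by
      rw [mul_pow, mul_pow, div_pow, show (4 : ℝ) ^ m = 2 ^ m * 2 ^ m by rw [← mul_pow]; norm_num]
      field_simp
    rw [heq]
    calc (2 / π) ^ m * (M * (R ^ m)⁻¹) ≤ 1 * (M * (R ^ m)⁻¹) :=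
          mul_le_mul_of_nonneg_right (pow_le_one₀ (by positivity : (0 : ℝ) ≤ 2 / π) h2π) (by positivity)
      _ = M * (R ^ m)⁻¹ := one_mul _
  refine hstep.trans (mul_le_mul_of_nonneg_left ?_ hM)
  have hprod : ∏ _p : d, ((R ^ N')⁻¹ : ℝ) = (R ^ m)⁻¹ := by
    rw [Finset.prod_const, Finset.card_univ, ← hm, inv_pow, ← pow_mul]
  rw [← hprod]
  refine Finset.prod_le_prod (fun p _ => by positivity) fun p _ => ?_
  have hle : max 1 |(k p : ℝ)| ≤ R := max_le hR1 (hp₀ p (Finset.mem_univ _))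
  have hpos : 0 < max 1 |(k p : ℝ)| := lt_of_lt_of_le one_pos (le_max_left _ _)
  exact inv_anti₀ (pow_pos hpos N') (pow_le_pow_left₀ hpos.le hle N')

/-- The weight `u(m) = (1+2|m|)^{N₁} (max 1 |m|)^{−(N₁+2)}` is dominated by `2·3^{N₁} (1+m²)⁻¹`. [folklore] -/
theorem weight_le (N₁ : ℕ) (m : ℤ) :
    (1 + 2 * |(m : ℝ)|) ^ N₁ * ((max 1 |(m : ℝ)|) ^ (N₁ + 2))⁻¹ ≤ 3 ^ N₁ * (2 * (1 + (m : ℝ) ^ 2)⁻¹) := by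
  set a : ℝ := max 1 |(m : ℝ)| with ha
  have ha1 : 1 ≤ a := le_max_left _ _
  have hma : |(m : ℝ)| ≤ a := le_max_right _ _
  have hapos : 0 < a := lt_of_lt_of_le one_pos ha1
  have h1 : (1 + 2 * |(m : ℝ)|) ^ N₁ ≤ 3 ^ N₁ * a ^ N₁ := by
    rw [← mul_pow]; exact pow_le_pow_left₀ (by positivity) (by linarith) N₁
  calc (1 + 2 * |(m : ℝ)|) ^ N₁ * (a ^ (N₁ + 2))⁻¹ ≤ 3 ^ N₁ * a ^ N₁ * (a ^ (N₁ + 2))⁻¹ :=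
        mul_le_mul_of_nonneg_right h1 (by positivity)
    _ = 3 ^ N₁ * (a ^ 2)⁻¹ := by rw [pow_add]; field_simp
    _ ≤ 3 ^ N₁ * (2 * (1 + (m : ℝ) ^ 2)⁻¹) :=
        mul_le_mul_of_nonneg_left (Torus.inv_max_sq_le_two_mul m) (by positivity)

/-- The weights `u(m)` are summable over `ℤ`. [folklore] -/
theorem summable_weight (N₁ : ℕ) :
    Summable fun m : ℤ => (1 + 2 * |(m : ℝ)|) ^ N₁ * ((max 1 |(m : ℝ)|) ^ (N₁ + 2))⁻¹ := by
  refine Summable.of_nonneg_of_le (fun m => by positivity) (weight_le N₁) ?_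
  exact (Torus.summable_inv_one_add_sq_int.mul_left 2).mul_left _

/-! ## §2 Tensorisation: single-slot synthesis ⇒ the crux's `n`-slot conclusion -/

/-- **Tensorisation** (the mathematics of the registered stub `stub_tensorisation` of crux AtomicSynthesis
⟨stmt-QuantumFields-28126⟩, LINE «SlotwiseSynthesis»; the conclusion is the skeleton's `SynthFor b` spelled out):
single-slot synthesis with constants `C₁, N₁` gives the crux's `n`-slot conclusion for `b` with `C = 2 C₁ B U⁴`,
`N = 4(N₁+2)`. [folklore] -/
theorem synthFor_of_slotSynth (b : SchwartzMap E4 ℝ) (C₁ : ℝ) (N₁ : ℕ) (hC₁ : 0 ≤ C₁) (hS : SlotSynth b C₁ N₁) :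
    ∃ (C : ℝ) (N : ℕ), 0 ≤ C ∧ ∀ (n : ℕ), 1 ≤ n →
      ∀ (F : SchwartzMap (Fin n → EuclideanSpace ℝ (Fin 4)) ℝ) (c : Fin n → EuclideanSpace ℝ (Fin 4))
        (ρ M : ℝ), 0 < ρ → tsupport F ⊆ {z | ∀ l, ‖z l - c l‖ ≤ ρ} →
        (∀ m : ℕ, m ≤ N * n → ∀ z, ‖iteratedFDeriv ℝ m F z‖ ≤ M / ρ ^ m) →
        ∃ (coef : ℕ → ℝ) (σ : ℕ → Fin n → ℝ) (η : ℕ → Fin n → EuclideanSpace ℝ (Fin 4)),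
          Summable (fun i => |coef i|) ∧ ∑' i, |coef i| ≤ C ^ n * M ∧
          (∀ i l, 0 < σ i l ∧ σ i l ≤ ρ ∧ ‖η i l - c l‖ ≤ 2 * ρ) ∧
          ∀ z, F z = ∑' i, coef i * ∏ l, b ((σ i l)⁻¹ • (z l - η i l)) := by
  -- the cutoff and its derivative bounds
  let χ : ContDiffBump (0 : EuclideanSpace ℝ (Fin 4)) := ⟨1, 3 / 2, by norm_num, by norm_num⟩
  have hχin : χ.rIn = 1 := rfl
  have hχout : χ.rOut = 3 / 2 := rfl
  obtain ⟨B, hB0, hB⟩ := Torus.exists_bound_iteratedFDeriv_bump χ N₁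
  -- the weights
  set u : ℤ → ℝ := fun m => (1 + 2 * |(m : ℝ)|) ^ N₁ * ((max 1 |(m : ℝ)|) ^ (N₁ + 2))⁻¹ with hu
  have hu0 : ∀ m, 0 ≤ u m := fun m => by positivity
  have hus : Summable u := summable_weight N₁
  set U : ℝ := ∑' m, u m with hU
  have hU0 : 0 ≤ U := tsum_nonneg hu0
  -- the bound of `b`
  obtain ⟨Bb, hBb0, hBb⟩ := exists_bound_schwartz b
  refine ⟨2 * C₁ * B * U ^ 4, 4 * (N₁ + 2), by positivity, ?_⟩
  intro n hn F c ρ M hρ hsupp hder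
  have hM0 : 0 ≤ M := by
    have := hder 0 (Nat.zero_le _) c
    rw [pow_zero, div_one] at this
    exact (norm_nonneg _).trans this
  -- (1) the product Fourier expansion
  obtain ⟨G, hGs, hG0, hGdec, hGexp⟩ := fourier_transport F c hρ (K := 4 * (N₁ + 2) * n) hsupp hder
  have hGw : ∀ k : Fin n × Fin 4 → ℤ, ‖G k‖ ≤ M * ∏ p, ((max 1 |(k p : ℝ)|) ^ (N₁ + 2))⁻¹ := by
    intro k
    refine prod_majorant k (N₁ + 2) (m := 4 * (N₁ + 2) * n) ?_ (norm_nonneg _) (hG0 k)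
      (fun p hp => hGdec k p hp _ le_rfl)
    rw [Fintype.card_prod, Fintype.card_fin, Fintype.card_fin]; ring
  -- (2) the slot syntheses
  set hhalf : EuclideanSpace ℝ (Fin 4) := WithLp.toLp 2 (fun _ : Fin 4 => (1 / 2 : ℝ)) with hhalf_def
  choose A σ η hAs hAle hgeo hAsum using fun (k : Fin n × Fin 4 → ℤ) (l : Fin n) =>
    slot_hasSum_atoms hS χ hχout hB (fun j => k (l, j)) hhalf (c l) hρ
  -- per-slot cost in product form
  have hAcost : ∀ (k : Fin n × Fin 4 → ℤ) (l : Fin n),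
      ∑' i, ‖A k l i‖ ≤ 2 * C₁ * B * ∏ j, (1 + 2 * |(k (l, j) : ℝ)|) ^ N₁ := by
    intro k l
    refine (hAle k l).trans ?_
    rw [show 2 * C₁ * (B * (1 + π / 2 * absSum (fun j => k (l, j))) ^ N₁) =
      2 * C₁ * B * (1 + π / 2 * absSum (fun j => k (l, j))) ^ N₁ by ring]
    exact mul_le_mul_of_nonneg_left (slot_cost_le_prod _ N₁) (by positivity)
  -- (3) the total coefficient family on `J = ℤ^{n×4} × (ℕ ⊕ ℕ)ⁿ`
  set W : (Fin n × Fin 4 → ℤ) × (Fin n → ℕ ⊕ ℕ) → ℂ := fun j => G j.1 * ∏ l, A j.1 l (j.2 l) with hW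
  set β : (Fin n × Fin 4 → ℤ) × (Fin n → ℕ ⊕ ℕ) → (Fin n → EuclideanSpace ℝ (Fin 4)) → ℝ :=
    fun j z => ∏ l, b ((σ j.1 l (j.2 l))⁻¹ • (z l - η j.1 l (j.2 l))) with hβ
  -- fibrewise ℓ¹ norms
  have hWk : ∀ k, Summable (fun ι : Fin n → ℕ ⊕ ℕ => ‖W (k, ι)‖) ∧
      ∑' ι : Fin n → ℕ ⊕ ℕ, ‖W (k, ι)‖ = ‖G k‖ * ∏ l, ∑' i, ‖A k l i‖ := by
    intro k
    have h1 := (summable_norm_prod_pi_and_tsum (fun l i => A k l i) (fun l => hAs k l)).1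
    have h2 := tsum_norm_prod_pi_eq (fun l i => A k l i) (fun l => hAs k l)
    refine ⟨?_, ?_⟩
    · simpa only [hW, norm_mul] using h1.mul_left ‖G k‖
    · simp only [hW, norm_mul]
      rw [tsum_mul_left, h2]
  have hcostk : ∀ k : Fin n × Fin 4 → ℤ,
      ‖G k‖ * ∏ l, ∑' i, ‖A k l i‖ ≤ M * (2 * C₁ * B) ^ n * ∏ p, u (k p) := by
    intro k
    have h1 : ∏ l, ∑' i, ‖A k l i‖ ≤ ∏ l, (2 * C₁ * B * ∏ j, (1 + 2 * |(k (l, j) : ℝ)|) ^ N₁) :=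
      Finset.prod_le_prod (fun l _ => tsum_nonneg fun _ => norm_nonneg _) fun l _ => hAcost k l
    have h2 : ∏ l, (2 * C₁ * B * ∏ j, (1 + 2 * |(k (l, j) : ℝ)|) ^ N₁) =
        (2 * C₁ * B) ^ n * ∏ p : Fin n × Fin 4, (1 + 2 * |(k p : ℝ)|) ^ N₁ := by
      rw [Finset.prod_mul_distrib, Finset.prod_const, Finset.card_univ, Fintype.card_fin, Fintype.prod_prod_type]
    rw [h2] at h1
    calc ‖G k‖ * ∏ l, ∑' i, ‖A k l i‖
        ≤ (M * ∏ p, ((max 1 |(k p : ℝ)|) ^ (N₁ + 2))⁻¹) *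
            ((2 * C₁ * B) ^ n * ∏ p : Fin n × Fin 4, (1 + 2 * |(k p : ℝ)|) ^ N₁) :=
          mul_le_mul (hGw k) h1 (Finset.prod_nonneg fun _ _ => tsum_nonneg fun _ => norm_nonneg _) (by positivity)
      _ = M * (2 * C₁ * B) ^ n * ∏ p, u (k p) := by
          simp only [hu]
          rw [Finset.prod_mul_distrib]
          ring
  have hmaj : Summable fun k : Fin n × Fin 4 → ℤ => M * (2 * C₁ * B) ^ n * ∏ p, u (k p) :=
    (summable_prod_pi_of_nonneg (fun (_ : Fin n × Fin 4) m => u m) (fun _ m => hu0 m) (fun _ => hus)).1.mul_left _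
  have hWsum : Summable (fun j : (Fin n × Fin 4 → ℤ) × (Fin n → ℕ ⊕ ℕ) => ‖W j‖) := by
    refine (summable_prod_of_nonneg (fun j => norm_nonneg _)).2 ⟨fun k => (hWk k).1, ?_⟩
    simp_rw [(hWk _).2]
    exact Summable.of_nonneg_of_le (fun k => by positivity) hcostk hmaj
  have hWtot : ∑' j, ‖W j‖ ≤ (2 * C₁ * B * U ^ 4) ^ n * M := by
    rw [hWsum.tsum_prod]
    simp_rw [(hWk _).2]
    have hfin : Summable fun k : Fin n × Fin 4 → ℤ => ‖G k‖ * ∏ l, ∑' i, ‖A k l i‖ :=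
      Summable.of_nonneg_of_le (fun k => by positivity) hcostk hmaj
    calc ∑' k, ‖G k‖ * ∏ l, ∑' i, ‖A k l i‖ ≤ ∑' k : Fin n × Fin 4 → ℤ, M * (2 * C₁ * B) ^ n * ∏ p, u (k p) :=
          hfin.tsum_le_tsum hcostk hmaj
      _ = M * (2 * C₁ * B) ^ n * ∏ _p : Fin n × Fin 4, U := by
          rw [tsum_mul_left, (summable_prod_pi_of_nonneg (fun (_ : Fin n × Fin 4) m => u m) (fun _ m => hu0 m)
            (fun _ => hus)).2]
      _ = (2 * C₁ * B * U ^ 4) ^ n * M := by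
          rw [Finset.prod_const, Finset.card_univ, Fintype.card_prod, Fintype.card_fin, Fintype.card_fin, pow_mul]
          ring
  -- (4) the expansion `F z = ∑_j W j β j z`
  -- slot values
  have hΘzero : ∀ (k : Fin n × Fin 4 → ℤ) (l : Fin n) (z : Fin n → EuclideanSpace ℝ (Fin 4)),
      2 * ρ ≤ ‖z l - c l‖ →
      χ (ρ⁻¹ • (z l - c l)) • eChar (fun j => k (l, j)) ((4 : ℝ)⁻¹ • (ρ⁻¹ • (z l - c l)) + hhalf) = 0 :=
    fun k l z hz => slot_eq_zero_of_le χ hχout _ hhalf (c l) hρ (by linarith)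
  have hχone : ∀ (z : Fin n → EuclideanSpace ℝ (Fin 4)), F z ≠ 0 → ∀ l, χ (ρ⁻¹ • (z l - c l)) = 1 := by
    intro z hz l
    refine χ.one_of_mem_closedBall ?_
    rw [hχin, Metric.mem_closedBall, dist_zero_right, norm_smul, norm_inv, Real.norm_of_nonneg hρ.le,
      inv_mul_le_iff₀ hρ, mul_one]
    exact hsupp (subset_tsupport _ hz) l
  -- inner sums (over the atoms of the `n` slots)
  have hinner : ∀ (k : Fin n × Fin 4 → ℤ) (z : Fin n → EuclideanSpace ℝ (Fin 4)),
      HasSum (fun ι : Fin n → ℕ ⊕ ℕ => (∏ l, A k l (ι l)) * ((β (k, ι) z : ℝ) : ℂ))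
        (∏ l, χ (ρ⁻¹ • (z l - c l)) • eChar (fun j => k (l, j)) ((4 : ℝ)⁻¹ • (ρ⁻¹ • (z l - c l)) + hhalf)) := by
    intro k z
    have hsl : ∀ l, Summable fun i => ‖A k l i * (b ((σ k l i)⁻¹ • (z l - η k l i)) : ℂ)‖ := by
      intro l
      refine Summable.of_nonneg_of_le (fun _ => norm_nonneg _) (fun i => ?_) ((hAs k l).mul_right Bb)
      rw [norm_mul, Complex.norm_real, Real.norm_eq_abs]
      exact mul_le_mul_of_nonneg_left (hBb _) (norm_nonneg _)
    have h := hasSum_prod_pi (R := ℂ) (fun l i => A k l i * (b ((σ k l i)⁻¹ • (z l - η k l i)) : ℂ)) hsl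
    have hval : ∀ l, ∑' i, A k l i * (b ((σ k l i)⁻¹ • (z l - η k l i)) : ℂ) =
        χ (ρ⁻¹ • (z l - c l)) • eChar (fun j => k (l, j)) ((4 : ℝ)⁻¹ • (ρ⁻¹ • (z l - c l)) + hhalf) :=
      fun l => (hAsum k l (z l)).tsum_eq
    simp_rw [hval] at h
    refine h.congr_fun fun ι => ?_
    simp only [hβ, Complex.ofReal_prod, ← Finset.prod_mul_distrib]
  -- outer sums (over the frequencies)
  have houter : ∀ z : Fin n → EuclideanSpace ℝ (Fin 4),
      HasSum (fun k : Fin n × Fin 4 → ℤ => G k *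
        ∏ l, χ (ρ⁻¹ • (z l - c l)) • eChar (fun j => k (l, j)) ((4 : ℝ)⁻¹ • (ρ⁻¹ • (z l - c l)) + hhalf))
        ((F z : ℝ) : ℂ) := by
    intro z
    by_cases hz : ∀ l, ‖z l - c l‖ < 2 * ρ
    · set P : ℝ := ∏ l, χ (ρ⁻¹ • (z l - c l)) with hP
      have h := (hGexp z hz).mul_left (P : ℂ)
      have hPF : (P : ℂ) * ((F z : ℝ) : ℂ) = ((F z : ℝ) : ℂ) := by
        by_cases hFz : F z = 0
        · rw [hFz]; simp
        · have : P = 1 := by rw [hP]; exact Finset.prod_eq_one fun l _ => hχone z hFz l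
          rw [this]; simp
      rw [hPF] at h
      refine h.congr_fun fun k => ?_
      simp only [Complex.real_smul, Finset.prod_mul_distrib, hP, Complex.ofReal_prod]
      ring
    · push Not at hz
      obtain ⟨l₀, hl₀⟩ := hz
      have hFz : F z = 0 := by
        by_contra hne
        have := hsupp (subset_tsupport _ hne) l₀
        linarith
      have hterm : ∀ k : Fin n × Fin 4 → ℤ,
          G k * ∏ l, χ (ρ⁻¹ • (z l - c l)) • eChar (fun j => k (l, j)) ((4 : ℝ)⁻¹ • (ρ⁻¹ • (z l - c l)) + hhalf)
            = 0 := by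
        intro k
        rw [Finset.prod_eq_zero (Finset.mem_univ l₀) (hΘzero k l₀ z hl₀), mul_zero]
      rw [hFz]
      simp only [hterm, Complex.ofReal_zero]
      exact hasSum_zero
  -- the expansion over `J`
  have hβbd : ∀ j z, |β j z| ≤ Bb ^ n := by
    intro j z
    rw [hβ, Finset.abs_prod]
    calc ∏ l, |b ((σ j.1 l (j.2 l))⁻¹ • (z l - η j.1 l (j.2 l)))| ≤ ∏ _l : Fin n, Bb :=
          Finset.prod_le_prod (fun _ _ => abs_nonneg _) fun l _ => hBb _
      _ = Bb ^ n := by rw [Finset.prod_const, Finset.card_univ, Fintype.card_fin]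
  have hexpJ : ∀ z : Fin n → EuclideanSpace ℝ (Fin 4),
      HasSum (fun j : (Fin n × Fin 4 → ℤ) × (Fin n → ℕ ⊕ ℕ) => W j * ((β j z : ℝ) : ℂ)) ((F z : ℝ) : ℂ) := by
    intro z
    have hsW : Summable fun j : (Fin n × Fin 4 → ℤ) × (Fin n → ℕ ⊕ ℕ) => W j * ((β j z : ℝ) : ℂ) := by
      refine Summable.of_norm_bounded (hWsum.mul_right (Bb ^ n)) fun j => ?_
      rw [norm_mul, Complex.norm_real, Real.norm_eq_abs]
      exact mul_le_mul_of_nonneg_left (hβbd j z) (norm_nonneg _)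
    have hfib : ∀ k : Fin n × Fin 4 → ℤ, HasSum (fun ι : Fin n → ℕ ⊕ ℕ => W (k, ι) * ((β (k, ι) z : ℝ) : ℂ))
        (G k * ∏ l, χ (ρ⁻¹ • (z l - c l)) • eChar (fun j => k (l, j)) ((4 : ℝ)⁻¹ • (ρ⁻¹ • (z l - c l)) + hhalf)) := by
      intro k
      have h := (hinner k z).mul_left (G k)
      refine h.congr_fun fun ι => ?_
      simp only [hW]
      ring
    have h := hsW.hasSum
    rwa [← (h.prod_fiberwise hfib).unique (houter z)]
  -- (5) real parts and re-enumeration by `ℕ`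
  haveI : Infinite (Fin n → ℕ ⊕ ℕ) := Pi.infinite_of_exists_right ⟨0, hn⟩
  obtain ⟨e⟩ : Nonempty (((Fin n × Fin 4 → ℤ) × (Fin n → ℕ ⊕ ℕ)) ≃ ℕ) := nonempty_equiv_of_countable
  refine ⟨fun i => (W (e.symm i)).re, fun i l => σ (e.symm i).1 l ((e.symm i).2 l),
    fun i l => η (e.symm i).1 l ((e.symm i).2 l), ?_, ?_, fun i l => hgeo _ l _, fun z => ?_⟩
  · -- summability of the real parts
    have h := (e.symm.summable_iff (f := fun j => ‖W j‖)).2 hWsum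
    refine Summable.of_nonneg_of_le (fun _ => abs_nonneg _) (fun i => ?_) h
    exact Complex.abs_re_le_norm _
  · -- the mass bound
    have h := (e.symm.summable_iff (f := fun j => ‖W j‖)).2 hWsum
    calc ∑' i, |(W (e.symm i)).re| ≤ ∑' i, ‖W (e.symm i)‖ :=
          Summable.tsum_le_tsum (fun i => Complex.abs_re_le_norm _)
            (Summable.of_nonneg_of_le (fun _ => abs_nonneg _) (fun i => Complex.abs_re_le_norm _) h) h
      _ = ∑' j, ‖W j‖ := e.symm.tsum_eq (fun j => ‖W j‖)
      _ ≤ (2 * C₁ * B * U ^ 4) ^ n * M := hWtot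
  · -- the representation
    have h1 : HasSum (fun j : (Fin n × Fin 4 → ℤ) × (Fin n → ℕ ⊕ ℕ) => Complex.reCLM (W j * ((β j z : ℝ) : ℂ)))
        (Complex.reCLM ((F z : ℝ) : ℂ)) := Complex.reCLM.hasSum (hexpJ z)
    have h2 : HasSum (fun j : (Fin n × Fin 4 → ℤ) × (Fin n → ℕ ⊕ ℕ) => (W j).re * β j z) (F z) := by
      simp only [Complex.reCLM_apply, Complex.mul_re, Complex.ofReal_re, Complex.ofReal_im, mul_zero,
        sub_zero] at h1
      exact h1
    have h3 := (e.symm.hasSum_iff (f := fun j => (W j).re * β j z)).2 h2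
    simp only [hβ, Function.comp_def] at h3
    exact (h3.tsum_eq).symm

/-! ## §3 The crux BY NAME (both routes) -/

/-- ★★★ **Crux AtomicSynthesis ⟨stmt-QuantumFields-28126⟩ of route OnsetTautology, BY NAME**: fixed-father-bump
tensor-atomic synthesis on `(ℝ⁴)ⁿ` with constants exponential in `n` and derivative order linear in `n` — from
`stub_singleSlot` (landed, `AtomicSynthesisMolliApprox`) and the tensorisation `synthFor_of_slotSynth` (this file).
[folklore] -/
theorem atomicSynthesis_proof : Summit.QuantumFields.YangMills.Theses.OnsetTautology.AtomicSynthesis := by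
  intro b hb hint
  obtain ⟨C₁, N₁, hC₁, hslot⟩ := stub_singleSlot b hb hint
  exact synthFor_of_slotSynth b C₁ N₁ hC₁ hslot

/-- The character-identical MarkovAtoms copy of the crux, BY NAME. [folklore] -/
theorem atomicSynthesis_proof' : Summit.QuantumFields.YangMills.Theses.MarkovAtoms.AtomicSynthesis := by
  intro b hb hint
  obtain ⟨C₁, N₁, hC₁, hslot⟩ := stub_singleSlot b hb hint
  exact synthFor_of_slotSynth b C₁ N₁ hC₁ hslot

end Summit.QuantumFields.YangMills.Theorems.AtomicSynthesisTensor

end
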